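import Literature.Topology.FourManifolds.BordismFourOrientation
import Literature.Topology.FourManifolds.LatticeFormsSylvester
import HarnessLib

/-!
# The Sylvester leaf `b₂ = b₂⁺ + b₂⁻` of `isOrientedBordant_iff_signature_eq` from Poincaré
duality and universal coefficients (Layer 4c of `Literature.Topology.FourManifolds.isOrientedBordant_iff_signature_eq`)

Sibling proof file of `Literature.Topology.FourManifolds.BordismFourOrientation`.  There the
forward direction of Thom's `σ(M) = σ(N) ↔ M ∼ N` (Thm IV.1, bordism invariance of the signature)
was proved down to textbook named facts, one of which is the signature split
`Literature.AlgebraicTopology.SingularHomology.sigPos_add_sigNeg_intersectionForm` (`b₂ = b₂⁺ + b₂⁻` for the cup form on `H²(P; ℤ)/T` of a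
closed oriented 4-manifold; Milnor–Husemoller 1973, §II.1 and §V.1).  Here that leaf is
*derived* from the core theorems already among the hypotheses:

* `Literature.Topology.FourManifolds.isPerfPair_cupPairingModTorsion_of_poincareDuality` — **Hatcher Prop. 3.38 / Cor. 3.39
  from Thm. 3.30 and Thm. 3.2**: for a closed `R`-oriented `n`-manifold over a PID `R`, the cup
  pairing `Hᵖ/T × Hᵠ/T → R`, `p + q = n`, is perfect, *given* Poincaré duality
  `D : Hᵖ ≅ H_q` (`bijective_poincareDualityMap`), surjectivity of the Kronecker map
  `h : Hᵠ → Hom(H_q, R)` with torsion kernel (universal coefficients, `kroneckerMap_surjective`,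
  `ker_kroneckerMap_le_torsion`) and finite generation of `Hᵖ`.  Proof as printed (Hatcher
  p. 250): `ψ ↦ (φ ↦ (φ ⌣ ψ)[M]) = D^* h(ψ)`, so the adjoint in `ψ` is `D^* ∘ h`, bijective modulo
  torsion; the adjoint in the other variable is then bijective because `Hᵖ/T` is finite free,
  hence reflexive (Mathlib `LinearMap.IsPerfPair.of_bijective`) — this replaces Hatcher's appeal
  to commutativity of the cup product.
* `Literature.Topology.FourManifolds.sigPos_add_sigNeg_intersectionForm_of_isPerfPair` — the leaf `b_k = b_k⁺ + b_k⁻` from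
  unimodularity (`isPerfPair_cupPairingModTorsion`), symmetry of the cup form for `k` even
  (graded commutativity `cupProduct_gradedComm`, Hatcher Thm. 3.11) and finiteness, by
  Sylvester's law of inertia on a lattice
  (`LinearMap.BilinForm.sigPos_add_sigNeg_eq_finrank_of_isSymm`, `LatticeFormsSylvester.lean`).
* `Literature.Topology.FourManifolds.isOrientedBordant_iff_signature_eq_of_facts'` — the `isOrientedBordant_iff_signature_eq`
  component of spc4.S36 with the hypothesis `hS`
  of `isOrientedBordant_iff_signature_eq_of_facts` replaced by graded commutativity of the cup
  product (`hc`); all other hypotheses unchanged (Spanier 6.3.5, 6.3.10, 6.3.12, 6.2.21; Hatcher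
  3.2 ×2, 3.30, A.8–A.9 ×3; Thom IV.13).

## References

* A. Hatcher, *Algebraic Topology*, CUP 2002, §3.3, Prop. 3.38 and Cor. 3.39 (p. 250), Thm. 3.30,
  §3.1 Thm. 3.2, §3.2 Thm. 3.11. [Hatcher2002]
* J. Milnor, D. Husemoller, *Symmetric bilinear forms*, Springer 1973, §II.1, §V.1. [MilnorHusemoller1973]
* R. Thom, *Quelques propriétés globales des variétés différentiables*, Comment. Math. Helv. 28
  (1954), Thm IV.1, Thm IV.13. [ThomCMH1954]
-/

noncomputable section

open scoped Manifold ContDiff Topology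
open Set CategoryTheory

universe u v

namespace Literature.Topology.FourManifolds

/-! ### Hatcher Prop. 3.38: the cup pairing modulo torsion is perfect, from PD and UCT -/

section CupPairing

variable {R : Type v} [CommRing R] [IsDomain R] [IsPrincipalIdealRing R]
  {X : Type u} [TopologicalSpace X] [CompactSpace X] [T2Space X] {n p q : ℕ}
  [ChartedSpace (EuclideanSpace ℝ (Fin n)) X]

omit [IsDomain R] [IsPrincipalIdealRing R] [CompactSpace X] [T2Space X]
  [ChartedSpace (EuclideanSpace ℝ (Fin n)) X] in
/-- The adjoint of the cup pairing modulo torsion in its second variable, through Poincaré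
duality and the Kronecker map: `Q [a] [b] = ⟨a ⌣ b, [X]⟩ = ⟨b, D a⟩ = h(b)(D a)`
(Hatcher 2002, §3.3, proof of Prop. 3.38, p. 250: "`D^* h` sends `ψ` to
`φ ↦ ψ([M] ⌢ φ) = (φ ⌣ ψ)[M]`"). [cite: Hatcher2002, §3.3 Prop. 3.38 (proof, p. 250)] -/
theorem cupPairingModTorsion_flip_mk_mk (μ : Literature.AlgebraicTopology.SingularHomology.HomologicalOrientation R X n) (h : p + q = n)
    (a : Literature.AlgebraicTopology.SingularHomology.singularCohomology R R X p) (b : Literature.AlgebraicTopology.SingularHomology.singularCohomology R R X q) :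
    (Literature.AlgebraicTopology.SingularHomology.cupPairingModTorsion μ h).flip (Literature.AlgebraicTopology.SingularHomology.freeCohomology.mk b) (Literature.AlgebraicTopology.SingularHomology.freeCohomology.mk a) =
      Literature.AlgebraicTopology.SingularHomology.kroneckerPairing R R X q b (Literature.AlgebraicTopology.SingularHomology.poincareDualityMap μ h a) := by
  rw [LinearMap.flip_apply, Literature.AlgebraicTopology.SingularHomology.cupPairingModTorsion_mk_mk,
    Literature.AlgebraicTopology.SingularHomology.cupPairing_eq_kroneckerPairing_poincareDualityMap]

/-- **The cup pairing modulo torsion is perfect** (Hatcher 2002, §3.3, Prop. 3.38 with "torsion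
in `H^*(M; ℤ)` factored out", and Cor. 3.39; the named fact `isPerfPair_cupPairingModTorsion`),
**derived from** Poincaré duality `D : Hᵖ(X; R) ≅ H_q(X; R)` (Thm. 3.30, `hD`), surjectivity
of the Kronecker map `h : Hᵠ(X; R) → Hom_R(H_q(X; R), R)` (Thm. 3.2, `hU`) with torsion kernel
(Thm. 3.2 and p. 196, `hK`), and finite generation of `Hᵖ(X; R)` (Cor. A.8–A.9, `hF`), over a
principal ideal domain `R`.  As printed (p. 250), the adjoint in the second variable is
`D^* ∘ h`, an isomorphism once torsion is factored out; the adjoint in the first variable is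
then an isomorphism because `Hᵖ/T` is finitely generated and free, hence reflexive (in place of
Hatcher's appeal to commutativity of `⌣`).  PROVED.
[cite: Hatcher2002, §3.3 Prop. 3.38 and Cor. 3.39 (p. 250)] -/
theorem isPerfPair_cupPairingModTorsion_of_poincareDuality (μ : Literature.AlgebraicTopology.SingularHomology.HomologicalOrientation R X n)
    (h : p + q = n) (hD : Literature.AlgebraicTopology.SingularHomology.bijective_poincareDualityMap μ h) (hU : Literature.AlgebraicTopology.SingularHomology.kroneckerMap_surjective R X q)
    (hK : LinearMap.ker (Literature.AlgebraicTopology.SingularHomology.kroneckerPairing R R X q) ≤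
      Submodule.torsion R ↥(Literature.AlgebraicTopology.SingularHomology.singularCohomology R R X q))
    (hF : Literature.AlgebraicTopology.SingularHomology.finite_singularCohomology_of_compactSpace R X n p) :
    Literature.AlgebraicTopology.SingularHomology.isPerfPair_cupPairingModTorsion μ h := by
  unfold Literature.AlgebraicTopology.SingularHomology.isPerfPair_cupPairingModTorsion
  haveI : Module.Finite R (Literature.AlgebraicTopology.SingularHomology.freeCohomology R X p) := Literature.AlgebraicTopology.SingularHomology.finite_freeCohomology hF
  haveI : Module.Free R (Literature.AlgebraicTopology.SingularHomology.freeCohomology R X p) := Literature.AlgebraicTopology.SingularHomology.free_freeCohomology hF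
  set D := Literature.AlgebraicTopology.SingularHomology.poincareDualityEquiv μ h hD with hDdef
  -- the adjoint in the second variable is bijective
  have hflip : Function.Bijective (Literature.AlgebraicTopology.SingularHomology.cupPairingModTorsion μ h).flip := by
    constructor
    · -- injective: `h(b) ∘ D = 0 ⇒ h(b) = 0 ⇒ b` torsion
      intro y₁ y₂ hy
      rw [← sub_eq_zero] at hy ⊢
      rw [← map_sub] at hy
      generalize y₁ - y₂ = y at hy ⊢
      induction y using Literature.AlgebraicTopology.SingularHomology.freeCohomology.induction_on with
      | h b =>
        rw [Literature.AlgebraicTopology.SingularHomology.freeCohomology.mk_eq_zero_iff]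
        refine hK (LinearMap.mem_ker.mpr (LinearMap.ext fun z => ?_))
        obtain ⟨a, rfl⟩ := hD.2 z
        rw [LinearMap.zero_apply, ← cupPairingModTorsion_flip_mk_mk, hy, LinearMap.zero_apply]
    · -- surjective: realise `φ ∘ mk ∘ D⁻¹ : H_q → R` as `h(b)`
      intro φ
      obtain ⟨b, hb⟩ := hU (φ ∘ₗ Literature.AlgebraicTopology.SingularHomology.freeCohomology.mk ∘ₗ (D.symm : Literature.AlgebraicTopology.SingularHomology.singularHomology R R X q →ₗ[R] _))
      refine ⟨Literature.AlgebraicTopology.SingularHomology.freeCohomology.mk b, LinearMap.ext fun x => ?_⟩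
      induction x using Literature.AlgebraicTopology.SingularHomology.freeCohomology.induction_on with
      | h a =>
        rw [cupPairingModTorsion_flip_mk_mk, hb, LinearMap.comp_apply, LinearMap.comp_apply,
          LinearEquiv.coe_coe, ← Literature.AlgebraicTopology.SingularHomology.poincareDualityEquiv_apply μ h hD, LinearEquiv.symm_apply_apply]
  have h1 : (Literature.AlgebraicTopology.SingularHomology.cupPairingModTorsion μ h).flip.IsPerfPair := LinearMap.IsPerfPair.of_bijective _ hflip
  have h2 := h1.flip
  rwa [LinearMap.flip_flip] at h2

end CupPairing

/-! ### The leaf `b_k = b_k⁺ + b_k⁻` from unimodularity, symmetry and Sylvester on a lattice -/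

section SignatureSplit

variable {X : Type u} [TopologicalSpace X] [CompactSpace X] [T2Space X] {k n : ℕ}
  [ChartedSpace (EuclideanSpace ℝ (Fin n)) X]

/-- **`b_k = b_k⁺ + b_k⁻` for the cup form of a closed oriented `2k`-manifold, `k` even**
(the named fact `sigPos_add_sigNeg_intersectionForm`; Milnor–Husemoller 1973, §II.1 and §V.1),
**derived from** unimodularity of the cup form (`isPerfPair_cupPairingModTorsion`, Hatcher
Cor. 3.39, `hP`), its symmetry for `k` even (graded commutativity of `⌣`, Hatcher Thm. 3.11,
`hc`) and finite generation of `Hᵏ(X; ℤ)` (`hF`), by Sylvester's law of inertia on the lattice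
`Hᵏ(X; ℤ)/T` (`LinearMap.BilinForm.sigPos_add_sigNeg_eq_finrank_of_isSymm`: a perfect pairing
has injective adjoint, i.e. is nondegenerate).  PROVED.
[cite: MilnorHusemoller1973, §II.1 and §V.1] [cite: Hatcher2002, §3.3 Cor. 3.39] -/
theorem sigPos_add_sigNeg_intersectionForm_of_isPerfPair (hk : Even k) (h : k + k = n)
    (μ : Literature.AlgebraicTopology.SingularHomology.HomologicalOrientation ℤ X n) (hP : Literature.AlgebraicTopology.SingularHomology.isPerfPair_cupPairingModTorsion μ h)
    (hc : Literature.AlgebraicTopology.SingularHomology.cupProduct_gradedComm ℤ X) (hF : Literature.AlgebraicTopology.SingularHomology.finite_singularCohomology_of_compactSpace ℤ X n k) :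
    Literature.AlgebraicTopology.SingularHomology.sigPos_add_sigNeg_intersectionForm hk h μ := by
  unfold Literature.AlgebraicTopology.SingularHomology.sigPos_add_sigNeg_intersectionForm
  haveI : Module.Finite ℤ (Literature.AlgebraicTopology.SingularHomology.freeCohomology ℤ X k) := Literature.AlgebraicTopology.SingularHomology.finite_freeCohomology hF
  haveI : (Literature.AlgebraicTopology.SingularHomology.intersectionForm h μ).IsPerfPair := Literature.AlgebraicTopology.SingularHomology.isPerfPair_intersectionForm h μ hP
  refine LinearMap.BilinForm.sigPos_add_sigNeg_eq_finrank_of_isSymm (Literature.AlgebraicTopology.SingularHomology.intersectionForm h μ)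
    (Literature.AlgebraicTopology.SingularHomology.isSymm_intersectionForm hc hk h μ) fun x hx => ?_
  refine (LinearMap.IsPerfPair.bijective_left (Literature.AlgebraicTopology.SingularHomology.intersectionForm h μ)).1 ?_
  rw [map_zero]
  exact LinearMap.ext hx

/-- The 4-dimensional instance from the core named facts: Poincaré duality (Thm. 3.30, `hD`),
universal coefficients (Thm. 3.2: `hU1` in degree `2`, `hU2` with `H₁` finitely generated),
finiteness of `H²` and `H₁` (Cor. A.8–A.9, `hF2`, `hF₁`) and graded commutativity (`hc`) give
`b₂ = b₂⁺ + b₂⁻` for every closed `ℤ`-oriented topological 4-manifold.  PROVED.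
[cite: MilnorHusemoller1973, §II.1 and §V.1] [cite: Hatcher2002, §3.3 Prop. 3.38] -/
theorem sigPos_add_sigNeg_intersectionForm_four_of_facts {P : Type u} [TopologicalSpace P]
    [T2Space P] [CompactSpace P] [ChartedSpace (EuclideanSpace ℝ (Fin 4)) P]
    (π : Literature.AlgebraicTopology.SingularHomology.HomologicalOrientation ℤ P 4) (hD : Literature.AlgebraicTopology.SingularHomology.bijective_poincareDualityMap π two_add_two_eq_four)
    (hU1 : Literature.AlgebraicTopology.SingularHomology.kroneckerMap_surjective ℤ P 2) (hU2 : Literature.AlgebraicTopology.SingularHomology.ker_kroneckerMap_le_torsion ℤ P 1)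
    (hF2 : Literature.AlgebraicTopology.SingularHomology.finite_singularCohomology_of_compactSpace ℤ P 4 2)
    (hF₁ : Literature.AlgebraicTopology.SingularHomology.finite_singularHomology_of_compactSpace ℤ P 4 1) (hc : Literature.AlgebraicTopology.SingularHomology.cupProduct_gradedComm ℤ P) :
    Literature.AlgebraicTopology.SingularHomology.sigPos_add_sigNeg_intersectionForm even_two two_add_two_eq_four π := by
  haveI : Module.Finite ℤ (Literature.AlgebraicTopology.SingularHomology.singularHomology ℤ ℤ P 1) := hF₁
  exact sigPos_add_sigNeg_intersectionForm_of_isPerfPair even_two two_add_two_eq_four π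
    (isPerfPair_cupPairingModTorsion_of_poincareDuality π _ hD hU1 hU2 hF2) hc hF2

end SignatureSplit

/-! ### The `isOrientedBordant_iff_signature_eq` component of spc4.S36, Sylvester leaf discharged -/

section SPC4

/-- **The `isOrientedBordant_iff_signature_eq` component of spc4.S36 from textbook named facts and
Thom's Thm IV.13, Sylvester leaf discharged**:
as `isOrientedBordant_iff_signature_eq_of_facts`, with its hypothesis `hS`
(`b₂ = b₂⁺ + b₂⁻`, Milnor–Husemoller §II.1) now derived from Poincaré duality, universal
coefficients and finiteness (already hypotheses) plus graded commutativity of the cup product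
(`hc`, Hatcher Thm. 3.11).  Remaining inputs: Spanier Thm. 6.3.5 (`h635`), Cor. 6.3.10
(`h6310`), Thm. 6.3.12 = Lefschetz duality (`hL`), Cor. 6.2.21 (`hFW`); Hatcher Thm. 3.2
(`hU1`, `hU2`), Thm. 3.30 (`hD`), Cor. A.8–A.9 (`hF2`, `hF₂`, `hF₁`), Thm. 3.11 (`hc`); and
Thom's Thm IV.13 (`h₂`, `Ω₄ ≅ ℤ` detected by the signature).  PROVED.
[cite: ThomCMH1954, Thm IV.1 and Thm IV.13; Thom1952, Cor. V.8] -/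
theorem isOrientedBordant_iff_signature_eq_of_facts'
    (h635 : ∀ {W : Type u} [TopologicalSpace W] [T2Space W] [CompactSpace W] [ConnectedSpace W]
      [ChartedSpace (EuclideanHalfSpace (4 + 1)) W]
      (h : ∃ z : ↥(Literature.AlgebraicTopology.SingularHomology.relativeSingularHomology ℤ ℤ W ((𝓡∂ (4 + 1)).boundary W) (4 + 1)), z ≠ 0),
      Literature.AlgebraicTopology.SingularHomology.relativeSingularHomology.exists_linearEquiv_of_ne_zero ℤ 4 W h)
    (h6310 : ∀ {W : Type u} [TopologicalSpace W] [T2Space W] [CompactSpace W]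
      [ChartedSpace (EuclideanHalfSpace (4 + 1)) W]
      (z : ↥(Literature.AlgebraicTopology.SingularHomology.relativeSingularHomology ℤ ℤ W ((𝓡∂ (4 + 1)).boundary W) (4 + 1)))
      (hz : Literature.AlgebraicTopology.SingularHomology.IsRelFundamentalClass ℤ ((𝓡∂ (4 + 1)).boundary W) z),
      Literature.AlgebraicTopology.SingularHomology.isGenerator_toLocal_δ_of_isRelFundamentalClass ℤ 4 W z hz)
    (hL : ∀ {W : Type u} [TopologicalSpace W] [T2Space W] [CompactSpace W]
      [ChartedSpace (EuclideanHalfSpace (4 + 1)) W]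
      (z : ↥(Literature.AlgebraicTopology.SingularHomology.relativeSingularHomology ℤ ℤ W ((𝓡∂ (4 + 1)).boundary W) (4 + 1)))
      (hz : Literature.AlgebraicTopology.SingularHomology.IsRelFundamentalClass ℤ ((𝓡∂ (4 + 1)).boundary W) z),
      Literature.AlgebraicTopology.SingularHomology.bijective_relCapProduct_of_isRelFundamentalClass ℤ 4 W z hz (show 2 + (2 + 1) = 4 + 1 by rfl))
    (hFW : ∀ {W : Type u} [TopologicalSpace W] [T2Space W] [CompactSpace W]
      [ChartedSpace (EuclideanHalfSpace (4 + 1)) W]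
      (z : ↥(Literature.AlgebraicTopology.SingularHomology.relativeSingularHomology ℤ ℤ W ((𝓡∂ (4 + 1)).boundary W) (4 + 1)))
      (hz : Literature.AlgebraicTopology.SingularHomology.IsRelFundamentalClass ℤ ((𝓡∂ (4 + 1)).boundary W) z),
      Literature.AlgebraicTopology.SingularHomology.finite_singularHomology_of_isRelFundamentalClass ℤ 4 W z hz 2)
    (hU1 : ∀ {W : Type u} [TopologicalSpace W], Literature.AlgebraicTopology.SingularHomology.kroneckerMap_surjective ℤ W 2)
    (hU2 : ∀ {X : Type u} [TopologicalSpace X], Literature.AlgebraicTopology.SingularHomology.ker_kroneckerMap_le_torsion ℤ X 1)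
    (hD : ∀ {P : Type u} [TopologicalSpace P] [T2Space P] [CompactSpace P]
      [ChartedSpace (EuclideanSpace ℝ (Fin 4)) P] (π : Literature.AlgebraicTopology.SingularHomology.HomologicalOrientation ℤ P 4),
      Literature.AlgebraicTopology.SingularHomology.bijective_poincareDualityMap π two_add_two_eq_four)
    (hF2 : ∀ {P : Type u} [TopologicalSpace P] [T2Space P] [CompactSpace P]
      [ChartedSpace (EuclideanSpace ℝ (Fin 4)) P], Literature.AlgebraicTopology.SingularHomology.finite_singularCohomology_of_compactSpace ℤ P 4 2)
    (hF₂ : ∀ {P : Type u} [TopologicalSpace P] [T2Space P] [CompactSpace P]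
      [ChartedSpace (EuclideanSpace ℝ (Fin 4)) P], Literature.AlgebraicTopology.SingularHomology.finite_singularHomology_of_compactSpace ℤ P 4 2)
    (hF₁ : ∀ {P : Type u} [TopologicalSpace P] [T2Space P] [CompactSpace P]
      [ChartedSpace (EuclideanSpace ℝ (Fin 4)) P], Literature.AlgebraicTopology.SingularHomology.finite_singularHomology_of_compactSpace ℤ P 4 1)
    (hc : ∀ {P : Type u} [TopologicalSpace P], Literature.AlgebraicTopology.SingularHomology.cupProduct_gradedComm ℤ P)
    (h₂ : isOrientedBordant_of_signature_eq.{u}) : isOrientedBordant_iff_signature_eq.{u} :=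
  isOrientedBordant_iff_signature_eq_of_facts h635 h6310 hL hFW hU1 (fun {X} _ => @hU2 X _) hD hF2
    hF₂ hF₁
    (fun π => sigPos_add_sigNeg_intersectionForm_four_of_facts π (hD π) hU1 (@hU2 _ _) hF2 hF₁ hc)
    h₂

end SPC4

end Literature.Topology.FourManifolds

end
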